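import Summits.Ventures.HSemireg.WedgeHankelRecurrenceCayleyTransform
import Summits.Ventures.HSemireg.WedgeHankelRecurrenceHurwitzCoefficients

/-!
# Venture HSemireg — JURY'S NECESSARY CONDITIONS IN EVERY DEGREE: a real Schur polynomial `p` of degree `n` with `lc(p) > 0` has **`p(1) > 0` and `(−1)ⁿ p(−1) > 0`**, and ALL coefficients of
# its Cayley transform `q(z) = (z−1)ⁿ p((z+1)/(z−1))` are positive — read off N205 (`q` is Hurwitz) and N198 (Hurwitz ⇒ coefficients of one sign), with `q_n = p(1)`, `q(1) = 2ⁿ lc(p)`,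
# `q(0) = (−1)ⁿ p(−1)`

HONEST FRAMING. Part of the Lean index of the computation cell `pub-hsemireg` (seat p10 gen 38, Sunday typer «UNIFORM-IN-n»).
REAL ∕ COMPLEX POLYNOMIALS ONLY: no variety, no cohomology theory, no sheaf, no Ext group and no semiregularity map is constructed here; nothing here says that HC / HC_CM / HC_AV holds; no Literature
fact (unproved `Prop`) is declared or used.  Custodian versions as in `WedgeHankelSiegelIdeal` (1/3).
SOURCE (cited; held text read): F–H §5.6 Exercise 14 (chunk p0267; typed as N205) and Prasolov Thm 1.1.14 ∕ F–H Exercise 15 (typed as N198).  THIS FILE (elementary corollaries; Jury's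
conditions `p(1) > 0`, `(−1)ⁿp(−1) > 0` are classical — E. I. Jury 1964 — no held locus claimed beyond F–H): bookkeeping `q(0) = (−1)ⁿ p(−1)` and the sign argument «all `q_k` have the sign of
`lc q = p(1)` and `Σ q_k = q(1) = 2ⁿ lc(p) > 0`, hence that sign is `+`».
DEDUP DISCLOSURE (`rg` of the whole tree + Mathlib, 2026-09-02): N207 is the full degree-two test; no general-degree Schur necessary condition in Literature ∕ Summits ∕ Mathlib.  5 names: 0 hits
tree-wide + Mathlib.

WHAT IS IN THE TREE.  N205 `cayleyPoly`, `eval_cayleyPoly`, `cayleyPoly_eval_one`, `coeff_cayleyPoly_self`, `natDegree_cayleyPoly`, `cayleyPoly_map`, `forall_norm_lt_one_iff_cayleyPoly_real`; N198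
`leadingCoeff_mul_coeff_pos_of_forall_re_neg`; Mathlib `eval_eq_sum_range`, `coeff_zero_eq_eval_zero`.
THIS FILE (namespace `Summit.Ventures.HSemireg.Wedge.HankelOuter` continued; CHAINED on N205 + N198; 0 definitions):
* §907 `cayleyPoly_eval_zero` (`q(0) = (−1)ⁿ p(−1)`), `eval_one_ne_zero_of_forall_norm_lt_one` (Schur ⇒ `p(1) ≠ 0`), **`coeff_cayleyPoly_pos_of_forall_norm_lt_one`** (real Schur `p`, `lc > 0`,
  `deg = n`: every `q_k > 0`, `k ≤ n`), **`eval_one_pos_of_forall_norm_lt_one`** (`p(1) > 0`), **`neg_one_pow_mul_eval_neg_one_pos_of_forall_norm_lt_one`** (`(−1)ⁿ p(−1) > 0`).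
CAVEATS.  Necessity only (sufficiency is false from degree 2 on: N207); `lc(p) > 0` assumed.  Nothing Ext-side.  New names only.
-/

open Module Polynomial
open scoped Matrix Polynomial

namespace Summit.Ventures.HSemireg.Wedge.HankelOuter

open Summit.Ventures.HSemireg.Wedge Summit.Ventures.HSemireg.Wedge.Hankel

/-! ## §907. `p(1) > 0`, `(−1)ⁿ p(−1) > 0` -/

/-- **`q(0) = (−1)ⁿ · p(−1)`** for the Cayley transform `q` of `p` read in degree `n ≥ deg p`. [this file §907] -/
theorem cayleyPoly_eval_zero {R : Type*} [CommRing R] {n : ℕ} {p : R[X]} (hp : p.natDegree ≤ n) : (cayleyPoly n p).eval 0 = (-1) ^ n * p.eval (-1) := by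
  rw [eval_cayleyPoly, eval_eq_sum_range' (Nat.lt_succ_of_le hp), Finset.mul_sum]
  refine Finset.sum_congr rfl fun k hk => ?_
  have hk' : k ≤ n := Nat.lt_succ_iff.1 (Finset.mem_range.1 hk)
  rw [zero_add, one_pow, mul_one, zero_sub]
  have : ((-1 : R)) ^ (n - k) = (-1) ^ n * (-1) ^ k := by
    rw [← pow_add, show n + k = (n - k) + 2 * k by omega, pow_add, pow_mul, neg_one_sq, one_pow, mul_one]
  rw [this]; ring

/-- A Schur polynomial does not vanish at `1`. [this file §907] -/
theorem eval_one_ne_zero_of_forall_norm_lt_one {p : ℝ[X]} (hp0 : p ≠ 0) (h : ∀ z ∈ (p.map (algebraMap ℝ ℂ)).roots, ‖z‖ < 1) : p.eval 1 ≠ 0 := by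
  intro h0
  have hmem : (1 : ℂ) ∈ (p.map (algebraMap ℝ ℂ)).roots := by
    rw [mem_roots ((Polynomial.map_ne_zero_iff (RingHom.injective _)).2 hp0), IsRoot.def, eval_map, ← map_one (algebraMap ℝ ℂ), eval₂_hom, h0, map_zero]
  have := h 1 hmem
  rw [norm_one] at this
  exact lt_irrefl _ this

/-- **All coefficients of the Cayley transform of a real Schur polynomial (`deg p = n`, `lc(p) > 0`) are positive.** (`q` is Hurwitz by N205, so its coefficients share the sign of `lc q = p(1)`
(N198); their sum `q(1) = 2ⁿ lc(p)` is positive, so the sign is `+`.) [this file §907] -/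
theorem coeff_cayleyPoly_pos_of_forall_norm_lt_one {n : ℕ} {p : ℝ[X]} (hp : p.natDegree = n) (hlc : 0 < p.leadingCoeff) (h : ∀ z ∈ (p.map (algebraMap ℝ ℂ)).roots, ‖z‖ < 1) :
    ∀ k ≤ n, 0 < (cayleyPoly n p).coeff k := by
  have hp0 : p ≠ 0 := leadingCoeff_ne_zero.1 hlc.ne'
  have h1 : p.eval 1 ≠ 0 := eval_one_ne_zero_of_forall_norm_lt_one hp0 h
  have hq : ∀ s ∈ ((cayleyPoly n p).map (algebraMap ℝ ℂ)).roots, s.re < 0 := (forall_norm_lt_one_iff_cayleyPoly_real hp h1).1 h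
  have hqd : (cayleyPoly n p).natDegree = n := natDegree_cayleyPoly hp.le h1
  have hq0 : cayleyPoly n p ≠ 0 := fun h0 => h1 (by rw [← coeff_cayleyPoly_self hp.le, h0, coeff_zero])
  have hsign := leadingCoeff_mul_coeff_pos_of_forall_re_neg hq0 hq
  rw [hqd] at hsign
  -- the sign of `lc q`: `lc q · q(1) = Σ lc q · q_k > 0` and `q(1) = 2ⁿ lc p > 0`
  have hq1 : (cayleyPoly n p).eval 1 = 2 ^ n * p.leadingCoeff := by rw [cayleyPoly_eval_one, leadingCoeff, hp]
  have hq1pos : 0 < (cayleyPoly n p).eval 1 := by rw [hq1]; positivity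
  have hlcq : 0 < (cayleyPoly n p).leadingCoeff := by
    have hsum : 0 < (cayleyPoly n p).leadingCoeff * (cayleyPoly n p).eval 1 := by
      rw [eval_eq_sum_range, hqd, Finset.mul_sum]
      refine Finset.sum_pos (fun k hk => ?_) ⟨0, by simp⟩
      rw [one_pow, mul_one]
      exact hsign k (Nat.lt_succ_iff.1 (Finset.mem_range.1 hk))
    exact (mul_pos_iff_of_pos_right hq1pos).1 hsum
  intro k hk
  exact (mul_pos_iff_of_pos_left hlcq).1 (hsign k hk)

/-- **JURY'S NECESSARY CONDITION `p(1) > 0`** for a real Schur polynomial of degree `n` with `lc(p) > 0` (`p(1) = q_n`). [this file §907] -/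
theorem eval_one_pos_of_forall_norm_lt_one {n : ℕ} {p : ℝ[X]} (hp : p.natDegree = n) (hlc : 0 < p.leadingCoeff) (h : ∀ z ∈ (p.map (algebraMap ℝ ℂ)).roots, ‖z‖ < 1) : 0 < p.eval 1 := by
  rw [← coeff_cayleyPoly_self hp.le]
  exact coeff_cayleyPoly_pos_of_forall_norm_lt_one hp hlc h n le_rfl

/-- **JURY'S NECESSARY CONDITION `(−1)ⁿ p(−1) > 0`** for a real Schur polynomial of degree `n` with `lc(p) > 0` (`(−1)ⁿ p(−1) = q_0 = q(0)`). [this file §907] -/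
theorem neg_one_pow_mul_eval_neg_one_pos_of_forall_norm_lt_one {n : ℕ} {p : ℝ[X]} (hp : p.natDegree = n) (hlc : 0 < p.leadingCoeff) (h : ∀ z ∈ (p.map (algebraMap ℝ ℂ)).roots, ‖z‖ < 1) :
    0 < (-1) ^ n * p.eval (-1) := by
  rw [← cayleyPoly_eval_zero hp.le, ← coeff_zero_eq_eval_zero]
  exact coeff_cayleyPoly_pos_of_forall_norm_lt_one hp hlc h 0 (Nat.zero_le _)

end Summit.Ventures.HSemireg.Wedge.HankelOuter
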